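import Literature.NumberTheory.ModularSymbols.FullLevelHomologyHeckeEquivariant
import Literature.NumberTheory.ModularSymbols.FullLevelHomologyTorusLevel
import HarnessLib

/-!
# The coefficient twist `M_θ : δ_x ↦ θ(det x)·δ_x` on `H₁(Γ₀(M), k[GL₂(ℤ/p)])`: an automorphism of the full-level
# carrier exchanging torus invariants and `θ∘det`-eigenvectors

Topic `Literature/NumberTheory/ModularSymbols`; namespace `Literature.NumberTheory.ModularSymbols.FullLevel`; sequel of
`FullLevelHomologyCarrier` (`coeff`, `H1carrier`, `H1carrierRep`, `symbol`) and `FullLevelHomologyHeckeEquivariant`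
(`H1carrierRep_H1π`, `coe_mapCycles₁_rightTranslation`).  Definitions with bodies + proved theorems; no named fact,
no `sorry`, no instance, no notation.

For a character `θ : (ℤ/p)ˣ → kˣ` the function `θ∘det` on `GL₂(ℤ/p)` is invariant under LEFT translation by
`Γ₀(M)` (which acts through `SL₂`), so multiplication of coefficients by `θ∘det` is an endomorphism of the
`Γ₀(M)`-representation `k[GL₂(ℤ/p)]`; on the space `Y(K(p)K₀(M)) = Γ₀(M)\(ℍ × GL₂(ℤ/p))` it is «multiply the
component of determinant `d` by `θ(d)`», i.e. the cup product with the class `θ∘det ∈ H⁰(Y, k)`.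

* `detChar k p θ x = θ(det x) ∈ k`; `detChar_redGL` (`= 1` on `Γ₀(M)`), `detChar_mul`, `detChar_inv_mul`.
* `coeffTwistLin`, **`coeffTwist k p M θ : coeff k p M ⟶ coeff k p M`** (`δ_x ↦ θ(det x)δ_x`, a morphism of
  `Γ₀(M)`-representations), `coeffTwist_hom_single`; `coeffTwistLin_rightTranslation`
  (`M_θ ∘ R_g = θ(det g⁻¹) · R_g ∘ M_θ`), `coeffTwistLin_coeffAct` (`M_θ ∘ L_g = θ(det g) · L_g ∘ M_θ`).
* **`H1coeffTwist k p M θ : H₁(Γ₀(M), k[GL₂(ℤ/p)]) →ₗ[k] H₁(Γ₀(M), k[GL₂(ℤ/p)])`** (functoriality of `H₁`),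
  `H1coeffTwist_H1π`, `H1coeffTwist_symbol` (`M_θ[γ ⊗ aδ_x] = θ(det x)·[γ ⊗ aδ_x]`), `H1coeffTwist_one`,
  `H1coeffTwist_mul` (`M_{θθ'} = M_θ ∘ M_{θ'}`), `H1coeffTwist_inv_apply` (`M_{θ⁻¹}(M_θ z) = z`),
  **`H1coeffTwist_H1carrierRep`** (`M_θ(g·z) = θ(det g⁻¹)·g·(M_θ z)`).
* `H1DetEigenspace k p M θ` (`= {z : t·z = θ(det t)·z ∀ t ∈ T̃}`), `H1DetEigenspace_one`
  (`= T̃`-invariants), **`H1coeffTwist_mem_H1DetEigenspace`** (`M_θ : Eig(θ') → Eig(θθ')`), and the two corollaries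
  `H1coeffTwist_mem_H1DetEigenspace_of_mem_invariants` (invariants `→ Eig(θ)`),
  `H1coeffTwist_mem_invariants_of_mem_H1DetEigenspace` (`Eig(θ') → ` invariants when `θθ' = 1`).

Consumer (motivation; nothing about it is asserted here): the K-line of route BSD/TeichmullerTwistDescent (crux
`TwistedPeriodLatticeSaturation`, memo KLINE-COMPOSED §2 (D4)–(D5)): with `θ` the quadratic character, `M_θ`
identifies the `χ∘det`-eigenvectors of the carrier (where the periods of `f ⊗ χ` are read) with torus invariants
(where the up/down dictionary to `H₁(X₀(p²M))` lives).

## References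
* A. Ash, G. Stevens, *Modular forms in characteristic ℓ and special values of their L-functions*, Duke Math. J. 53
  (1986), §1 (1.2)–(1.3) (the `GL₂(ℤ/p)`-module structure; components indexed by `det`). [AshStevens1986]
* K. S. Brown, *Cohomology of Groups* (1982), Ch. III §5–§6, §8 (functoriality in the coefficients). [Brown1982]
* B. Mazur, J. Tate, J. Teitelbaum, Invent. Math. 84 (1986), §I.8 (twisting by `χ∘det`). [MazurTateTeitelbaum1986]
-/

noncomputable section

namespace Literature.NumberTheory.ModularSymbols

namespace FullLevel

open scoped MatrixGroups
open CategoryTheory CongruenceSubgroup groupHomology Finsupp Matrix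
open Literature.Algebra.Homology

variable (k : Type) [CommRing k] (p M : ℕ)

/-! ### The function `θ∘det` on `GL₂(ℤ/p)` -/

/-- `θ(det x) ∈ k` for `x ∈ GL₂(ℤ/p)` and a character `θ : (ℤ/p)ˣ → kˣ`. [cite: AshStevens1986, §1 (1.2)] -/
def detChar (θ : (ZMod p)ˣ →* kˣ) (x : GL (Fin 2) (ZMod p)) : k :=
  ((θ (Matrix.GeneralLinearGroup.det x) : kˣ) : k)

/-- Unfolding `detChar`. [cite: AshStevens1986, §1 (1.2)] -/
theorem detChar_apply (θ : (ZMod p)ˣ →* kˣ) (x : GL (Fin 2) (ZMod p)) :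
    detChar k p θ x = ((θ (Matrix.GeneralLinearGroup.det x) : kˣ) : k) := rfl

/-- `θ(det(xy)) = θ(det x) θ(det y)`. [cite: AshStevens1986, §1 (1.2)] -/
theorem detChar_mul (θ : (ZMod p)ˣ →* kˣ) (x y : GL (Fin 2) (ZMod p)) :
    detChar k p θ (x * y) = detChar k p θ x * detChar k p θ y := by
  rw [detChar, detChar, detChar, map_mul, map_mul, Units.val_mul]

/-- `θ(det 1) = 1`. [cite: AshStevens1986, §1 (1.2)] -/
@[simp] theorem detChar_one_right (θ : (ZMod p)ˣ →* kˣ) : detChar k p θ 1 = 1 := by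
  rw [detChar, map_one, map_one, Units.val_one]

/-- `θ(det x⁻¹) θ(det x) = 1`. [cite: AshStevens1986, §1 (1.2)] -/
theorem detChar_inv_mul (θ : (ZMod p)ˣ →* kˣ) (x : GL (Fin 2) (ZMod p)) :
    detChar k p θ x⁻¹ * detChar k p θ x = 1 := by
  rw [← detChar_mul, inv_mul_cancel, detChar_one_right]

/-- `θ(det x) θ(det x⁻¹) = 1`. [cite: AshStevens1986, §1 (1.2)] -/
theorem detChar_mul_inv (θ : (ZMod p)ˣ →* kˣ) (x : GL (Fin 2) (ZMod p)) :
    detChar k p θ x * detChar k p θ x⁻¹ = 1 := by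
  rw [← detChar_mul, mul_inv_cancel, detChar_one_right]

/-- The trivial character gives the constant function `1`. [cite: AshStevens1986, §1 (1.2)] -/
@[simp] theorem detChar_one_left (x : GL (Fin 2) (ZMod p)) : detChar k p (1 : (ZMod p)ˣ →* kˣ) x = 1 := by
  rw [detChar, MonoidHom.one_apply, Units.val_one]

/-- Product of characters. [cite: AshStevens1986, §1 (1.2)] -/
theorem detChar_mul_left (θ θ' : (ZMod p)ˣ →* kˣ) (x : GL (Fin 2) (ZMod p)) :
    detChar k p (θ * θ') x = detChar k p θ x * detChar k p θ' x := by
  rw [detChar, detChar, detChar, MonoidHom.mul_apply, Units.val_mul]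

/-- Characters with `θ(u)θ'(u) = 1` give `θ(det x)θ'(det x) = 1`. [cite: AshStevens1986, §1 (1.2)] -/
theorem detChar_mul_detChar_eq_one (θ θ' : (ZMod p)ˣ →* kˣ) (h : ∀ u, θ u * θ' u = 1) (x : GL (Fin 2) (ZMod p)) :
    detChar k p θ x * detChar k p θ' x = 1 := by
  rw [detChar, detChar, ← Units.val_mul, h, Units.val_one]

/-- `θ(u) θ⁻¹(u) = 1`. [cite: AshStevens1986, §1 (1.2)] -/
theorem apply_mul_inv_apply (θ : (ZMod p)ˣ →* kˣ) (u : (ZMod p)ˣ) : θ u * θ⁻¹ u = 1 := by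
  rw [MonoidHom.inv_apply, mul_inv_cancel]

/-- `θ⁻¹(u) θ(u) = 1`. [cite: AshStevens1986, §1 (1.2)] -/
theorem inv_apply_mul_apply (θ : (ZMod p)ˣ →* kˣ) (u : (ZMod p)ˣ) : θ⁻¹ u * θ u = 1 := by
  rw [MonoidHom.inv_apply, inv_mul_cancel]

/-- `det (γ mod p) = 1` for `γ ∈ Γ₀(M) ≤ SL₂(ℤ)`. [cite: DiamondShurman2005, §1.2] -/
theorem det_redGL (γ : Gamma0 M) : Matrix.GeneralLinearGroup.det (redGL p M γ) = 1 := by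
  apply Units.ext
  rw [Matrix.GeneralLinearGroup.val_det_apply, Units.val_one]
  exact (Matrix.SpecialLinearGroup.map (Int.castRingHom (ZMod p)) (γ : SL(2, ℤ))).det_coe

/-- `θ(det γ̄) = 1` for `γ ∈ Γ₀(M)`. [cite: DiamondShurman2005, §1.2] -/
@[simp] theorem detChar_redGL (θ : (ZMod p)ˣ →* kˣ) (γ : Gamma0 M) : detChar k p θ (redGL p M γ) = 1 := by
  rw [detChar, det_redGL, map_one, Units.val_one]

/-! ### The coefficient twist `δ_x ↦ θ(det x)·δ_x` on `k[GL₂(ℤ/p)]` -/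

/-- `M_θ : k[GL₂(ℤ/p)] → k[GL₂(ℤ/p)]`, `aδ_x ↦ θ(det x)·aδ_x`, as a `k`-linear map. [cite: MazurTateTeitelbaum1986, §I.8] -/
def coeffTwistLin (θ : (ZMod p)ˣ →* kˣ) : coeff k p M →ₗ[k] coeff k p M :=
  Finsupp.lsum k fun x => detChar k p θ x • Finsupp.lsingle x

/-- `M_θ(aδ_x) = (θ(det x) a)δ_x`. [cite: MazurTateTeitelbaum1986, §I.8] -/
@[simp] theorem coeffTwistLin_single (θ : (ZMod p)ˣ →* kˣ) (x : GL (Fin 2) (ZMod p)) (a : k) :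
    coeffTwistLin k p M θ (single x a) = single x (detChar k p θ x * a) := by
  rw [coeffTwistLin]
  erw [Finsupp.lsum_single]
  rw [LinearMap.smul_apply, Finsupp.lsingle_apply, Finsupp.smul_single, smul_eq_mul]

/-- `M_1 = id`. [cite: MazurTateTeitelbaum1986, §I.8] -/
theorem coeffTwistLin_one (f : coeff k p M) : coeffTwistLin k p M (1 : (ZMod p)ˣ →* kˣ) f = f := by
  induction f using Finsupp.induction_linear with
  | zero => simp
  | add f₁ f₂ h₁ h₂ => rw [map_add, h₁, h₂]
  | single x a => rw [coeffTwistLin_single, detChar_one_left, one_mul]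

/-- `M_{θθ'} = M_θ ∘ M_{θ'}`. [cite: MazurTateTeitelbaum1986, §I.8] -/
theorem coeffTwistLin_mul (θ θ' : (ZMod p)ˣ →* kˣ) (f : coeff k p M) :
    coeffTwistLin k p M (θ * θ') f = coeffTwistLin k p M θ (coeffTwistLin k p M θ' f) := by
  induction f using Finsupp.induction_linear with
  | zero => simp
  | add f₁ f₂ h₁ h₂ => rw [map_add, h₁, h₂, map_add, map_add]
  | single x a => rw [coeffTwistLin_single, coeffTwistLin_single, coeffTwistLin_single, detChar_mul_left, mul_assoc]

/-- `M_θ` commutes with LEFT translation by `g` up to the scalar `θ(det g)`: `M_θ(g ⋆ f) = θ(det g)·(g ⋆ M_θ f)`.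
[cite: MazurTateTeitelbaum1986, §I.8] -/
theorem coeffTwistLin_coeffAct (θ : (ZMod p)ˣ →* kˣ) (g : GL (Fin 2) (ZMod p)) (f : coeff k p M) :
    coeffTwistLin k p M θ (coeffAct k p M g f) = detChar k p θ g • coeffAct k p M g (coeffTwistLin k p M θ f) := by
  induction f using Finsupp.induction_linear with
  | zero => simp
  | add f₁ f₂ h₁ h₂ => rw [map_add, map_add, h₁, h₂, map_add, map_add, smul_add]
  | single x a =>
    rw [coeffAct_single, coeffTwistLin_single, coeffTwistLin_single, coeffAct_single, Finsupp.smul_single, smul_eq_mul,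
      detChar_mul, mul_assoc]

/-- `M_θ` commutes with the `Γ₀(M)`-action (`det γ̄ = 1`). [cite: MazurTateTeitelbaum1986, §I.8] -/
theorem coeffTwistLin_ρ (θ : (ZMod p)ˣ →* kˣ) (γ : Gamma0 M) (f : coeff k p M) :
    coeffTwistLin k p M θ ((coeff k p M).ρ γ f) = (coeff k p M).ρ γ (coeffTwistLin k p M θ f) := by
  rw [coeff_ρ_eq_coeffAct, coeffTwistLin_coeffAct, detChar_redGL, one_smul]

/-- `M_θ` commutes with RIGHT translation `R_g` up to the scalar `θ(det g⁻¹)`: `M_θ(R_g f) = θ(det g⁻¹)·R_g(M_θ f)`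
(`R_g δ_x = δ_{xg⁻¹}`). [cite: MazurTateTeitelbaum1986, §I.8] -/
theorem coeffTwistLin_rightTranslation (θ : (ZMod p)ˣ →* kˣ) (g : GL (Fin 2) (ZMod p)) (f : coeff k p M) :
    coeffTwistLin k p M θ ((PermutationCoeff.rightTranslation (k := k) (redGL p M) g).hom f) =
      detChar k p θ g⁻¹ • (PermutationCoeff.rightTranslation (k := k) (redGL p M) g).hom (coeffTwistLin k p M θ f) := by
  induction f using Finsupp.induction_linear with
  | zero => simp
  | add f₁ f₂ h₁ h₂ => rw [map_add, map_add, h₁, h₂, map_add, map_add, smul_add]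
  | single x a =>
    rw [PermutationCoeff.rightTranslation_single, coeffTwistLin_single, coeffTwistLin_single,
      PermutationCoeff.rightTranslation_single, Finsupp.smul_single, smul_eq_mul, detChar_mul, mul_comm (detChar k p θ x),
      mul_assoc]

/-- **The coefficient twist as a morphism of `Γ₀(M)`-representations** `M_θ : k[GL₂(ℤ/p)] ⟶ k[GL₂(ℤ/p)]`.
[cite: MazurTateTeitelbaum1986, §I.8] -/
def coeffTwist (θ : (ZMod p)ˣ →* kˣ) : coeff k p M ⟶ coeff k p M :=
  Rep.ofHom ((coeffTwistLin k p M θ).intertwiningMap_of_isIntertwiningMap _ _ (fun γ f =>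
    coeffTwistLin_ρ k p M θ γ f))

/-- `(M_θ).hom = coeffTwistLin`. [cite: MazurTateTeitelbaum1986, §I.8] -/
theorem coeffTwist_hom_apply (θ : (ZMod p)ˣ →* kˣ) (f : coeff k p M) :
    (coeffTwist k p M θ).hom f = coeffTwistLin k p M θ f := rfl

/-- `M_θ(aδ_x) = (θ(det x) a)δ_x`. [cite: MazurTateTeitelbaum1986, §I.8] -/
theorem coeffTwist_hom_single (θ : (ZMod p)ˣ →* kˣ) (x : GL (Fin 2) (ZMod p)) (a : k) :
    (coeffTwist k p M θ).hom (single x a) = single x (detChar k p θ x * a) :=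
  coeffTwistLin_single k p M θ x a

/-- `M_θ = 𝟙` when `θ∘det ≡ 1` (e.g. `θ = 1`). [cite: MazurTateTeitelbaum1986, §I.8] -/
theorem coeffTwist_eq_id_of_detChar_eq_one (θ : (ZMod p)ˣ →* kˣ) (h : ∀ x, detChar k p θ x = 1) :
    coeffTwist k p M θ = 𝟙 _ := by
  refine Rep.hom_ext (Representation.IntertwiningMap.ext ?_)
  ext x a
  simp only [coeffTwist]
  erw [coeffTwistLin_single, h, one_mul]
  rfl

/-- `M_1 = 𝟙`. [cite: MazurTateTeitelbaum1986, §I.8] -/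
theorem coeffTwist_one : coeffTwist k p M (1 : (ZMod p)ˣ →* kˣ) = 𝟙 _ :=
  coeffTwist_eq_id_of_detChar_eq_one k p M 1 (detChar_one_left k p)

/-- `M_{θθ'} = M_{θ'} ≫ M_θ`. [cite: MazurTateTeitelbaum1986, §I.8] -/
theorem coeffTwist_mul (θ θ' : (ZMod p)ˣ →* kˣ) :
    coeffTwist k p M (θ * θ') = coeffTwist k p M θ' ≫ coeffTwist k p M θ := by
  refine Rep.hom_ext (Representation.IntertwiningMap.ext ?_)
  ext x a
  simp only [Rep.hom_comp, Representation.IntertwiningMap.comp_toLinearMap, LinearMap.coe_comp,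
    Function.comp_apply, Representation.IntertwiningMap.toLinearMap_apply, lsingle_apply]
  rw [coeffTwist_hom_apply, coeffTwist_hom_apply, coeffTwist_hom_apply, coeffTwistLin_mul]

/-! ### The twist on `H₁(Γ₀(M), k[GL₂(ℤ/p)])` -/

/-- **The coefficient twist on the full-level carrier** `M_θ : H₁(Γ₀(M), k[GL₂(ℤ/p)]) → H₁(Γ₀(M), k[GL₂(ℤ/p)])`
(functoriality of `H₁` in the coefficients). [cite: Brown1982, Ch. III §8; MazurTateTeitelbaum1986, §I.8] -/
def H1coeffTwist (θ : (ZMod p)ˣ →* kˣ) : H1carrier k p M →ₗ[k] H1carrier k p M :=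
  (groupHomology.map (MonoidHom.id (Gamma0 M)) (coeffTwist k p M θ) 1).hom

/-- `M_θ [c] = [M_θ c]` on classes of `1`-cycles. [cite: Brown1982, Ch. III §8] -/
theorem H1coeffTwist_H1π (θ : (ZMod p)ˣ →* kˣ) (c : cycles₁ (coeff k p M)) :
    H1coeffTwist k p M θ (H1π _ c) = H1π _ (mapCycles₁ (MonoidHom.id _) (coeffTwist k p M θ) c) := by
  rw [H1coeffTwist]
  exact groupHomology.H1π_comp_map_apply (A := coeff k p M) (B := coeff k p M) (MonoidHom.id _) (coeffTwist k p M θ) c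

/-- The chain underlying `M_θ c` is `mapRange M_θ c`. [cite: Brown1982, Ch. III §8] -/
theorem coe_mapCycles₁_coeffTwist (θ : (ZMod p)ˣ →* kˣ) (c : cycles₁ (coeff k p M)) :
    (mapCycles₁ (MonoidHom.id _) (coeffTwist k p M θ) c).1 =
      mapRange.linearMap (coeffTwistLin k p M θ) c.1 := by
  rw [coe_mapCycles₁]
  simp only [ModuleCat.hom_ofHom, LinearMap.coe_comp, Function.comp_apply, lmapDomain_apply, MonoidHom.coe_id,
    mapDomain_id]
  rfl

/-- **`M_θ` on a full-level symbol**: `M_θ[γ ⊗ aδ_x] = θ(det x)·[γ ⊗ aδ_x]`. [cite: AshStevens1986, §1 (1.3)] -/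
theorem H1coeffTwist_symbol [Fact p.Prime] (θ : (ZMod p)ˣ →* kˣ) (γ : principalLevel p M) (x : GL (Fin 2) (ZMod p))
    (a : k) : H1coeffTwist k p M θ (symbol k p M γ x a) = detChar k p θ x • symbol k p M γ x a := by
  rw [symbol, PermutationCoeff.stabSymbol, H1coeffTwist_H1π, ← map_smul]
  congr 1
  apply Subtype.ext
  rw [coe_mapCycles₁_coeffTwist, Submodule.coe_smul, mapRange.linearMap_apply, mapRange_single, coeffTwistLin_single,
    Finsupp.smul_single, Finsupp.smul_single, smul_eq_mul]

/-- `M_θ = id` on `H₁` when `θ∘det ≡ 1`. [cite: Brown1982, Ch. III §8] -/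
theorem H1coeffTwist_eq_self_of_detChar_eq_one (θ : (ZMod p)ˣ →* kˣ) (h : ∀ x, detChar k p θ x = 1)
    (z : H1carrier k p M) : H1coeffTwist k p M θ z = z := by
  rw [H1coeffTwist, coeffTwist_eq_id_of_detChar_eq_one k p M θ h, groupHomology.map_id]
  rfl

/-- `M_1 = id`. [cite: Brown1982, Ch. III §8] -/
theorem H1coeffTwist_one (z : H1carrier k p M) : H1coeffTwist k p M (1 : (ZMod p)ˣ →* kˣ) z = z :=
  H1coeffTwist_eq_self_of_detChar_eq_one k p M 1 (detChar_one_left k p) z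

/-- `M_{θθ'} = M_θ ∘ M_{θ'}`. [cite: Brown1982, Ch. III §8] -/
theorem H1coeffTwist_mul (θ θ' : (ZMod p)ˣ →* kˣ) (z : H1carrier k p M) :
    H1coeffTwist k p M (θ * θ') z = H1coeffTwist k p M θ (H1coeffTwist k p M θ' z) := by
  rw [H1coeffTwist, coeffTwist_mul, groupHomology.map_id_comp]
  rfl

/-- `M_θ(M_{θ'} z) = z` when `θθ' = 1` pointwise (e.g. `θ' = θ⁻¹`, or `θ' = θ` quadratic). [cite: Brown1982, Ch. III §8] -/
theorem H1coeffTwist_H1coeffTwist_of_mul_eq_one (θ θ' : (ZMod p)ˣ →* kˣ) (h : ∀ u, θ u * θ' u = 1)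
    (z : H1carrier k p M) : H1coeffTwist k p M θ (H1coeffTwist k p M θ' z) = z := by
  rw [← H1coeffTwist_mul]
  refine H1coeffTwist_eq_self_of_detChar_eq_one k p M _ (fun x => ?_) z
  rw [detChar_mul_left, detChar_mul_detChar_eq_one k p θ θ' h]

/-- `M_{θ⁻¹}(M_θ z) = z`. [cite: Brown1982, Ch. III §8] -/
theorem H1coeffTwist_inv_apply (θ : (ZMod p)ˣ →* kˣ) (z : H1carrier k p M) :
    H1coeffTwist k p M θ⁻¹ (H1coeffTwist k p M θ z) = z :=
  H1coeffTwist_H1coeffTwist_of_mul_eq_one k p M θ⁻¹ θ (inv_apply_mul_apply k p θ) z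

/-- `M_θ(M_{θ⁻¹} z) = z`. [cite: Brown1982, Ch. III §8] -/
theorem H1coeffTwist_apply_inv (θ : (ZMod p)ˣ →* kˣ) (z : H1carrier k p M) :
    H1coeffTwist k p M θ (H1coeffTwist k p M θ⁻¹ z) = z :=
  H1coeffTwist_H1coeffTwist_of_mul_eq_one k p M θ θ⁻¹ (apply_mul_inv_apply k p θ) z

/-- For an involutive character (`θ(u)² = 1`, e.g. the quadratic character), `M_θ` is an involution.
[cite: MazurTateTeitelbaum1986, §I.8] -/
theorem H1coeffTwist_H1coeffTwist_of_mul_self (θ : (ZMod p)ˣ →* kˣ) (hθ : ∀ u, θ u * θ u = 1) (z : H1carrier k p M) :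
    H1coeffTwist k p M θ (H1coeffTwist k p M θ z) = z :=
  H1coeffTwist_H1coeffTwist_of_mul_eq_one k p M θ θ hθ z

/-- `M_θ` is injective. [cite: Brown1982, Ch. III §8] -/
theorem H1coeffTwist_injective (θ : (ZMod p)ˣ →* kˣ) : Function.Injective (H1coeffTwist k p M θ) :=
  fun z₁ z₂ h => by simpa [H1coeffTwist_inv_apply k p M] using congrArg (H1coeffTwist k p M θ⁻¹) h

/-- `M_θ` is surjective. [cite: Brown1982, Ch. III §8] -/
theorem H1coeffTwist_surjective (θ : (ZMod p)ˣ →* kˣ) : Function.Surjective (H1coeffTwist k p M θ) :=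
  fun z => ⟨H1coeffTwist k p M θ⁻¹ z, H1coeffTwist_apply_inv k p M θ z⟩

/-- **`M_θ` and the `GL₂(ℤ/p)`-action**: `M_θ(g·z) = θ(det g⁻¹)·(g·M_θ z)`. [cite: AshStevens1986, §1 (1.2); MazurTateTeitelbaum1986, §I.8] -/
theorem H1coeffTwist_H1carrierRep (θ : (ZMod p)ˣ →* kˣ) (g : GL (Fin 2) (ZMod p)) (z : H1carrier k p M) :
    H1coeffTwist k p M θ (H1carrierRep k p M g z) = detChar k p θ g⁻¹ • H1carrierRep k p M g (H1coeffTwist k p M θ z) := by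
  induction z using H1_induction_on with
  | h c =>
    rw [H1carrierRep_H1π, H1coeffTwist_H1π, H1coeffTwist_H1π, H1carrierRep_H1π, ← map_smul]
    congr 1
    apply Subtype.ext
    rw [coe_mapCycles₁_coeffTwist, coe_mapCycles₁_rightTranslation, Submodule.coe_smul, coe_mapCycles₁_rightTranslation,
      coe_mapCycles₁_coeffTwist]
    ext γ : 1
    simp only [mapRange.linearMap_apply, mapRange_apply, Finsupp.coe_smul, Pi.smul_apply]
    exact coeffTwistLin_rightTranslation k p M θ g (c.1 γ)

/-- The same with the scalar on the other side: `g·(M_θ z) = θ(det g)·M_θ(g·z)`. [cite: AshStevens1986, §1 (1.2)] -/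
theorem H1carrierRep_H1coeffTwist (θ : (ZMod p)ˣ →* kˣ) (g : GL (Fin 2) (ZMod p)) (z : H1carrier k p M) :
    H1carrierRep k p M g (H1coeffTwist k p M θ z) = detChar k p θ g • H1coeffTwist k p M θ (H1carrierRep k p M g z) := by
  rw [H1coeffTwist_H1carrierRep, smul_smul, detChar_mul_inv, one_smul]

/-! ### Torus eigenspaces for `θ∘det` and what `M_θ` does to them -/

/-- The `θ∘det`-eigenspace of the diagonal torus `T̃` in the carrier:
`{z : t·z = θ(det t)·z for all t ∈ T̃}` (for `θ = 1` the `T̃`-invariants). [cite: Bump1997, §4.1] -/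
def H1DetEigenspace [Fact p.Prime] (θ : (ZMod p)ˣ →* kˣ) : Submodule k (H1carrier k p M) where
  carrier := {z | ∀ t ∈ diagTorus (ZMod p), H1carrierRep k p M t z = detChar k p θ t • z}
  add_mem' {z₁ z₂} h₁ h₂ t ht := by rw [map_add, h₁ t ht, h₂ t ht, smul_add]
  zero_mem' t _ := by rw [map_zero, smul_zero]
  smul_mem' c z hz t ht := by
    show H1carrierRep k p M t (c • z) = detChar k p θ t • c • z
    rw [map_smul, hz t ht, smul_comm]

variable [Fact p.Prime]

/-- Membership in `H1DetEigenspace`. [cite: Bump1997, §4.1] -/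
theorem mem_H1DetEigenspace_iff (θ : (ZMod p)ˣ →* kˣ) (z : H1carrier k p M) :
    z ∈ H1DetEigenspace k p M θ ↔ ∀ t ∈ diagTorus (ZMod p), H1carrierRep k p M t z = detChar k p θ t • z := Iff.rfl

/-- For `θ = 1` the eigenspace is the space of `T̃`-invariants. [cite: Bump1997, §4.1] -/
theorem mem_H1DetEigenspace_one_iff (z : H1carrier k p M) :
    z ∈ H1DetEigenspace k p M (1 : (ZMod p)ˣ →* kˣ) ↔
      z ∈ PermutationCoeff.H1Invariants k (redGL p M) (diagTorus (ZMod p)) := by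
  rw [mem_H1DetEigenspace_iff, PermutationCoeff.mem_H1Invariants_iff]
  constructor
  · intro h t
    have := h t.1 t.2
    rwa [detChar_one_left, one_smul] at this
  · intro h t ht
    rw [detChar_one_left, one_smul]
    exact h ⟨t, ht⟩

/-- `H1DetEigenspace 1 = T̃`-invariants. [cite: Bump1997, §4.1] -/
theorem H1DetEigenspace_one :
    H1DetEigenspace k p M (1 : (ZMod p)ˣ →* kˣ) = PermutationCoeff.H1Invariants k (redGL p M) (diagTorus (ZMod p)) :=
  Submodule.ext fun z => mem_H1DetEigenspace_one_iff k p M z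

/-- **`M_θ` shifts torus eigencharacters by `θ∘det`**: `M_θ : Eig(θ') → Eig(θθ')`. [cite: Bump1997, §4.1; MazurTateTeitelbaum1986, §I.8] -/
theorem H1coeffTwist_mem_H1DetEigenspace (θ θ' : (ZMod p)ˣ →* kˣ) {z : H1carrier k p M}
    (hz : z ∈ H1DetEigenspace k p M θ') : H1coeffTwist k p M θ z ∈ H1DetEigenspace k p M (θ * θ') := by
  intro t ht
  rw [H1carrierRep_H1coeffTwist, hz t ht, map_smul, smul_smul, detChar_mul_left]

/-- `M_θ` maps `T̃`-invariants to `θ∘det`-eigenvectors. [cite: Bump1997, §4.1] -/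
theorem H1coeffTwist_mem_H1DetEigenspace_of_mem_invariants (θ : (ZMod p)ˣ →* kˣ) {z : H1carrier k p M}
    (hz : z ∈ PermutationCoeff.H1Invariants k (redGL p M) (diagTorus (ZMod p))) :
    H1coeffTwist k p M θ z ∈ H1DetEigenspace k p M θ := by
  intro t ht
  rw [H1carrierRep_H1coeffTwist, (PermutationCoeff.mem_H1Invariants_iff (redGL p M) _ z).1 hz ⟨t, ht⟩]

/-- `M_θ` maps `θ'∘det`-eigenvectors to `T̃`-invariants when `θθ' = 1` pointwise. [cite: Bump1997, §4.1] -/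
theorem H1coeffTwist_mem_invariants_of_mem_H1DetEigenspace (θ θ' : (ZMod p)ˣ →* kˣ) (hθ : ∀ u, θ u * θ' u = 1)
    {z : H1carrier k p M} (hz : z ∈ H1DetEigenspace k p M θ') :
    H1coeffTwist k p M θ z ∈ PermutationCoeff.H1Invariants k (redGL p M) (diagTorus (ZMod p)) := by
  rw [PermutationCoeff.mem_H1Invariants_iff]
  intro t
  show H1carrierRep k p M (t : GL (Fin 2) (ZMod p)) (H1coeffTwist k p M θ z) = H1coeffTwist k p M θ z
  rw [H1carrierRep_H1coeffTwist, hz t.1 t.2, map_smul, smul_smul, detChar_mul_detChar_eq_one k p θ θ' hθ, one_smul]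

/-- For an involutive character (`θ(u)² = 1`): `z` is a `θ∘det`-eigenvector iff `M_θ z` is `T̃`-invariant.
[cite: Bump1997, §4.1; MazurTateTeitelbaum1986, §I.8] -/
theorem mem_H1DetEigenspace_iff_H1coeffTwist_mem_invariants (θ : (ZMod p)ˣ →* kˣ) (hθ : ∀ u, θ u * θ u = 1)
    (z : H1carrier k p M) :
    z ∈ H1DetEigenspace k p M θ ↔
      H1coeffTwist k p M θ z ∈ PermutationCoeff.H1Invariants k (redGL p M) (diagTorus (ZMod p)) := by
  constructor
  · exact H1coeffTwist_mem_invariants_of_mem_H1DetEigenspace k p M θ θ hθ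
  · intro h
    have h' := H1coeffTwist_mem_H1DetEigenspace_of_mem_invariants k p M θ h
    rwa [H1coeffTwist_H1coeffTwist_of_mul_self k p M θ hθ] at h'

/-- The eigenspace `Eig(θ)` is the image of the `T̃`-invariants under `M_θ` (involutive `θ`).
[cite: Bump1997, §4.1; MazurTateTeitelbaum1986, §I.8] -/
theorem H1DetEigenspace_eq_map_invariants (θ : (ZMod p)ˣ →* kˣ) (hθ : ∀ u, θ u * θ u = 1) :
    H1DetEigenspace k p M θ =
      (PermutationCoeff.H1Invariants k (redGL p M) (diagTorus (ZMod p))).map (H1coeffTwist k p M θ) := by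
  ext z
  rw [Submodule.mem_map]
  constructor
  · intro hz
    exact ⟨H1coeffTwist k p M θ z, (mem_H1DetEigenspace_iff_H1coeffTwist_mem_invariants k p M θ hθ z).1 hz,
      H1coeffTwist_H1coeffTwist_of_mul_self k p M θ hθ z⟩
  · rintro ⟨w, hw, rfl⟩
    exact H1coeffTwist_mem_H1DetEigenspace_of_mem_invariants k p M θ hw

end FullLevel

end Literature.NumberTheory.ModularSymbols
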